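import Summits.RiemannHypothesis.RiemannHypothesis.Theorems.Splittings.RobinFiniteE1cUpperNicolas
import Literature.NumberTheory.LFunctions.RiemannHypothesisUpTo100000X
import HarnessLib

/-!
# E1c⁺ part 4 — COMPUTATIONAL CLOSURE: Nicolas's inequality at `p#` for every prime `p ≤ 1.5·10⁹`, UNCONDITIONALLY, by discharging
# RH up to `10⁵` with the tree's certificate `riemannHypothesisUpTo_100000` (U11; `--computational`: exactly RHT100000's 16 `native_decide` companions)

Pub cell `rh-split` (robin, finite) gen 10, CARVE-g10 part 4 (additive to parts 1–3; independent of part 3b) of the checked object `SketchG10-Upper.lean` (v3, bodies verbatim,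
one shared namespace `Summit.RiemannHypothesis.RiemannHypothesis.Theorems.Splittings.RobinFiniteE1c`).  Zero `def`, zero `sorry`,
no `native_decide` in this file; its ONE theorem discharges `RiemannHypothesisUpTo 100000` by the tree's `riemannHypothesisUpTo_100000` and
therefore inherits exactly that certificate's 16 `Literature.NumberTheory.LFunctions.RHT100000.*._native.native_decide.ax_1_1`
companions (file `--computational`; nothing else in CARVE-g10 does).
SPLITTING SEARCH over kernel-typed RH-EQUIVALENCES; a splitting A ∧ B ⟹ RH is CONDITIONAL bookkeeping unless A and B are
both proved; nothing here bears on the truth of RH.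
-/

set_option linter.dupNamespace false

noncomputable section

open Complex Filter Set MeasureTheory Topology intervalIntegral
open scoped Real Chebyshev ComplexConjugate

namespace Summit.RiemannHypothesis.RiemannHypothesis.Theorems.Splittings.RobinFiniteE1c

open Literature.NumberTheory.LFunctions Literature.NumberTheory.DiophantineGeometry
open Nicolas NicolasJ NicolasFz NicolasK NicolasJExplicit

/-! ### U11 · computational closure: the RH(10⁵) hypothesis DISCHARGED by the tree's certificate `riemannHypothesisUpTo_100000` (this block alone inherits its 16 `native_decide` companion axioms; carve part 4, `--computational`) -/

/-- **HEADLINE (g10, UNCONDITIONAL): Nicolas's inequality `e^γ log log N_k < N_k/φ(N_k)` holds at the primorial `N_k = p#` of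
EVERY prime `p ≤ 1.5·10⁹`** — `nicolasInequality_primorial_of_rh1e5` with RH up to `10⁵` DISCHARGED by the tree's theorem
`riemannHypothesisUpTo_100000` (compiled Riemann–Siegel sign certificate: this instance inherits that theorem's `native_decide`
axioms; everything else is standard-axiom kernel).  Print: Nicolas 2012, §4 checked `c(N_k) ≥ c(2) > 0` for `k ≤ π(10⁹)` in 30-digit floating point (Maple);
Nicolas 1983 Thm 2(a) / 2012 (2.19) give every `k` under RH.  Nothing here bears on the truth of RH. -/
theorem nicolasInequality_primorial_of_le_1500000000 {p : ℕ} (hp : p.Prime) (hle : p ≤ 1500000000) :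
    nicolasInequality (primorial p) :=
  nicolasInequality_primorial_of_rh1e5 riemannHypothesisUpTo_100000 hp hle

end Summit.RiemannHypothesis.RiemannHypothesis.Theorems.Splittings.RobinFiniteE1c

end
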